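import Summits.CriticalPhenomena.PercolationContinuityZ3.Theorems.PercNearOneGluingNoHeavyPcintChordDiagramCount
import HarnessLib

/-!
# CriticalPhenomena/PercolationContinuityZ3 — Theorems/PercNearOneGluingNoHeavyPcintDefectDiagrams.lean: ONE-DEFECT STRUCTURES as a chord diagram with a marked pair of chords; the two SWITCHED diagrams (combinatorial core of STRUCTURE law C5-L4, part 1)

Lane prim-pcint, STRUCTURE rule «numerics ⇒ structure ⇒ conjecture» (prim-pcint-2 GEN 21; law C5-L4 = prediction P22, typed in
…PcintSubleadingChordLaw).  The SUB-LEADING coefficient of the rooted oriented `2m`-gon count of `ℤ^d` counts closing words that use one axis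
FOUR times (twice in each direction) and `m − 2` axes twice.  Modulo axis labels and orientations such a word is a ONE-DEFECT STRUCTURE on the `2m`
linearly ordered steps: `m − 2` chords and a 4-block `Q` carrying two `+` and two `−` signs.  We encode it as an ordinary chord diagram `π`
(fixed-point-free involution, …PcintChordDiagrams) together with a MARKED PAIR OF CHORDS, given by their openers `a < b` (`IsPair π a b`): the two
marked chords `{a, π a}`, `{b, π b}` are the two SAME-SIGN pairs of `Q = {a, π a, b, π b}` (`quad π a b`).  The blocks of steps that cancel are
then governed not by `π` but by the two SWITCHED diagrams, which re-pair `Q` into opposite-sign pairs: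
* `switchP π a b`: `a ↔ b`, `π a ↔ π b` (and `π` elsewhere);  `switchX π a b`: `a ↔ π b`, `b ↔ π a`;
* both are diagrams (`isDiag_switchP/X`), and **a set is closed for one of them iff it is `π`-closed off `Q` and BALANCED on `Q`**
  (`closed_switch_or_iff`: `#(I ∩ {a, π a}) = #(I ∩ {b, π b})`) — the combinatorial shadow of "the `Q`-letters in the block cancel";
* `defectSet α`: the triples `(π, a, b)` whose two switched diagrams are BOTH irreducible; its cardinality on `Fin (2m)` is the one-defect number
  `b(m)` of law C5-L4 (`0, 3, 62, 1205, 24105, 507892, …`; equivalently the number of edges of the switch graph on irreducible diagrams).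
The sequels …PcintDefectWordDiagram/Structure/Count identify the closing words of length `2m` spanning `m − 1` axes with these structures.

HONEST FRAMING: elementary finite combinatorics written for the mechanism theorem of law C5-L4 (all `m`).  No `sorry`; standard axioms.
Written by prim-pcint-2 gen 21 (prover-prim-pcint-2-g21-0), 2026-08-27.
-/

namespace Summit.CriticalPhenomena.PercolationContinuityZ3.Theorems.Pcint.ChordDiag

variable {α : Type*} [LinearOrder α]

/-! ### A marked pair of chords -/

/-- `a`, `b` open two distinct chords of `π`, `a` before `b`: `a < π a`, `b < π b`, `a < b`, `b ≠ π a`. [folklore] -/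
def IsPair (π : α → α) (a b : α) : Prop := a < π a ∧ b < π b ∧ a < b ∧ b ≠ π a

/-- The 4-block `Q = {a, π a, b, π b}` of the marked pair. [folklore] -/
def quad (π : α → α) (a b : α) : Finset α := {a, π a, b, π b}

section Pair

variable {π : α → α} {a b : α}

/-- Membership in the 4-block. [folklore] -/
theorem mem_quad {x : α} : x ∈ quad π a b ↔ x = a ∨ x = π a ∨ x = b ∨ x = π b := by
  simp [quad]

/-- The six distinctness facts of a marked pair. [folklore] -/
theorem IsPair.distinct (hd : IsDiag π) (h : IsPair π a b) :
    a ≠ π a ∧ b ≠ π b ∧ a ≠ b ∧ b ≠ π a ∧ a ≠ π b ∧ π a ≠ π b := by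
  obtain ⟨h1, h2, h3, h4⟩ := h
  refine ⟨h1.ne, h2.ne, h3.ne, h4, fun h5 => h4 ?_, fun h6 => h3.ne (hd.injective h6)⟩
  rw [h5, (hd b).1]

/-- `π` maps the 4-block to itself. [folklore] -/
theorem mem_quad_apply (hd : IsDiag π) {x : α} : π x ∈ quad π a b ↔ x ∈ quad π a b := by
  rw [mem_quad, mem_quad]
  constructor
  · rintro (h | h | h | h)
    · right; left; rw [← h, (hd x).1]
    · left; exact hd.injective h
    · right; right; right; rw [← h, (hd x).1]
    · right; right; left; exact hd.injective h
  · rintro (rfl | rfl | rfl | rfl)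
    · right; left; rfl
    · left; exact (hd a).1
    · right; right; right; rfl
    · right; right; left; exact (hd b).1

/-! ### The two switched diagrams -/

/-- The PARALLEL switch: re-pair `Q` as `a ↔ b`, `π a ↔ π b`. [folklore] -/
def switchP (π : α → α) (a b : α) : α → α := fun x =>
  if x = a then b else if x = b then a else if x = π a then π b else if x = π b then π a else π x

/-- The CROSS switch: re-pair `Q` as `a ↔ π b`, `b ↔ π a`. [folklore] -/
def switchX (π : α → α) (a b : α) : α → α := fun x =>
  if x = a then π b else if x = π b then a else if x = b then π a else if x = π a then b else π x

/-- Off the 4-block both switches agree with `π`. [folklore] -/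
theorem switchP_of_not_mem {x : α} (hx : x ∉ quad π a b) : switchP π a b x = π x := by
  rw [mem_quad] at hx
  push Not at hx
  simp [switchP, hx.1, hx.2.1, hx.2.2.1, hx.2.2.2]

/-- Off the 4-block both switches agree with `π`. [folklore] -/
theorem switchX_of_not_mem {x : α} (hx : x ∉ quad π a b) : switchX π a b x = π x := by
  rw [mem_quad] at hx
  push Not at hx
  simp [switchX, hx.1, hx.2.1, hx.2.2.1, hx.2.2.2]

/-- The values of the parallel switch on the 4-block. [folklore] -/
theorem switchP_vals (hd : IsDiag π) (h : IsPair π a b) :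
    switchP π a b a = b ∧ switchP π a b b = a ∧ switchP π a b (π a) = π b ∧ switchP π a b (π b) = π a := by
  obtain ⟨d1, d2, d3, d4, d5, d6⟩ := h.distinct hd
  refine ⟨by simp [switchP], by simp [switchP, d3.symm], ?_, ?_⟩
  · simp [switchP, d1.symm, Ne.symm d4]
  · simp [switchP, Ne.symm d5, d2.symm, Ne.symm d6]

/-- The values of the cross switch on the 4-block. [folklore] -/
theorem switchX_vals (hd : IsDiag π) (h : IsPair π a b) :
    switchX π a b a = π b ∧ switchX π a b (π b) = a ∧ switchX π a b b = π a ∧ switchX π a b (π a) = b := by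
  obtain ⟨d1, d2, d3, d4, d5, d6⟩ := h.distinct hd
  refine ⟨by simp [switchX], ?_, ?_, ?_⟩
  · simp [switchX, Ne.symm d5]
  · simp [switchX, d3.symm, d2]
  · simp [switchX, d1.symm, d6, Ne.symm d4]

/-- The parallel switch is a diagram. [folklore] -/
theorem isDiag_switchP (hd : IsDiag π) (h : IsPair π a b) : IsDiag (switchP π a b) := by
  obtain ⟨d1, d2, d3, d4, d5, d6⟩ := h.distinct hd
  obtain ⟨v1, v2, v3, v4⟩ := switchP_vals hd h
  intro x
  by_cases hx : x ∈ quad π a b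
  · rcases mem_quad.1 hx with rfl | rfl | rfl | rfl
    · rw [v1, v2]; exact ⟨rfl, d3.symm⟩
    · rw [v3, v4]; exact ⟨rfl, d6.symm⟩
    · rw [v2, v1]; exact ⟨rfl, d3⟩
    · rw [v4, v3]; exact ⟨rfl, d6⟩
  · have hx' : π x ∉ quad π a b := fun h' => hx ((mem_quad_apply hd).1 h')
    rw [switchP_of_not_mem hx, switchP_of_not_mem hx']
    exact hd x

/-- The cross switch is a diagram. [folklore] -/
theorem isDiag_switchX (hd : IsDiag π) (h : IsPair π a b) : IsDiag (switchX π a b) := by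
  obtain ⟨d1, d2, d3, d4, d5, d6⟩ := h.distinct hd
  obtain ⟨v1, v2, v3, v4⟩ := switchX_vals hd h
  intro x
  by_cases hx : x ∈ quad π a b
  · rcases mem_quad.1 hx with rfl | rfl | rfl | rfl
    · rw [v1, v2]; exact ⟨rfl, d5.symm⟩
    · rw [v4, v3]; exact ⟨rfl, d4⟩
    · rw [v3, v4]; exact ⟨rfl, Ne.symm d4⟩
    · rw [v2, v1]; exact ⟨rfl, d5⟩
  · have hx' : π x ∉ quad π a b := fun h' => hx ((mem_quad_apply hd).1 h')
    rw [switchX_of_not_mem hx, switchX_of_not_mem hx']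
    exact hd x

/-! ### Closed sets of the switched diagrams: `π`-closed off `Q`, balanced on `Q` -/

/-- The `Q`-count of a set on the first marked chord minus … : `#(I ∩ {a, π a})` and `#(I ∩ {b, π b})` as sums of indicators. [folklore] -/
def qcount (x y : α) (I : Finset α) : ℕ := (if x ∈ I then 1 else 0) + (if y ∈ I then 1 else 0)

/-- A set is BALANCED on the 4-block if it meets the two marked chords equally often. [folklore] -/
def Balanced (π : α → α) (a b : α) (I : Finset α) : Prop := qcount a (π a) I = qcount b (π b) I

/-- **Closed for the parallel switch** iff `π`-closed off `Q`, and `a ∈ I ↔ b ∈ I`, `π a ∈ I ↔ π b ∈ I`. [folklore] -/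
theorem closed_switchP_iff (hd : IsDiag π) (h : IsPair π a b) (I : Finset α) :
    Closed (switchP π a b) I ↔
      (∀ x, x ∉ quad π a b → x ∈ I → π x ∈ I) ∧ (a ∈ I ↔ b ∈ I) ∧ (π a ∈ I ↔ π b ∈ I) := by
  obtain ⟨v1, v2, v3, v4⟩ := switchP_vals hd h
  constructor
  · intro hc
    refine ⟨fun x hx hxI => ?_, ⟨fun ha => ?_, fun hb => ?_⟩, ⟨fun ha => ?_, fun hb => ?_⟩⟩
    · rw [← switchP_of_not_mem hx]; exact hc hxI
    · have := hc ha; rwa [v1] at this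
    · have := hc hb; rwa [v2] at this
    · have := hc ha; rwa [v3] at this
    · have := hc hb; rwa [v4] at this
  · rintro ⟨hoff, hab, hpab⟩ x hxI
    by_cases hx : x ∈ quad π a b
    · rcases mem_quad.1 hx with rfl | rfl | rfl | rfl
      · rw [v1]; exact hab.1 hxI
      · rw [v3]; exact hpab.1 hxI
      · rw [v2]; exact hab.2 hxI
      · rw [v4]; exact hpab.2 hxI
    · rw [switchP_of_not_mem hx]; exact hoff x hx hxI

/-- **Closed for the cross switch** iff `π`-closed off `Q`, and `a ∈ I ↔ π b ∈ I`, `b ∈ I ↔ π a ∈ I`. [folklore] -/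
theorem closed_switchX_iff (hd : IsDiag π) (h : IsPair π a b) (I : Finset α) :
    Closed (switchX π a b) I ↔
      (∀ x, x ∉ quad π a b → x ∈ I → π x ∈ I) ∧ (a ∈ I ↔ π b ∈ I) ∧ (b ∈ I ↔ π a ∈ I) := by
  obtain ⟨v1, v2, v3, v4⟩ := switchX_vals hd h
  constructor
  · intro hc
    refine ⟨fun x hx hxI => ?_, ⟨fun ha => ?_, fun hb => ?_⟩, ⟨fun ha => ?_, fun hb => ?_⟩⟩
    · rw [← switchX_of_not_mem hx]; exact hc hxI
    · have := hc ha; rwa [v1] at this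
    · have := hc hb; rwa [v2] at this
    · have := hc ha; rwa [v3] at this
    · have := hc hb; rwa [v4] at this
  · rintro ⟨hoff, hab, hba⟩ x hxI
    by_cases hx : x ∈ quad π a b
    · rcases mem_quad.1 hx with rfl | rfl | rfl | rfl
      · rw [v1]; exact hab.1 hxI
      · rw [v4]; exact hba.2 hxI
      · rw [v3]; exact hba.1 hxI
      · rw [v2]; exact hab.2 hxI
    · rw [switchX_of_not_mem hx]; exact hoff x hx hxI

/-- **Closed for one of the two switched diagrams iff `π`-closed off `Q` and balanced on `Q`.** [folklore] -/
theorem closed_switch_or_iff (hd : IsDiag π) (h : IsPair π a b) (I : Finset α) :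
    (Closed (switchP π a b) I ∨ Closed (switchX π a b) I) ↔
      (∀ x, x ∉ quad π a b → x ∈ I → π x ∈ I) ∧ Balanced π a b I := by
  rw [closed_switchP_iff hd h, closed_switchX_iff hd h]
  unfold Balanced qcount
  by_cases h1 : a ∈ I <;> by_cases h2 : π a ∈ I <;> by_cases h3 : b ∈ I <;> by_cases h4 : π b ∈ I <;>
    simp only [h1, h2, h3, h4] <;> simp

/-! ### The set of one-defect structures with both switched diagrams irreducible -/

variable [Fintype α]

open Classical in
/-- The ONE-DEFECT STRUCTURES on `α` whose two switched diagrams are both irreducible: triples `(π, a, b)` with `π` a diagram, `(a, b)` a marked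
pair of chords, `switchP π a b` and `switchX π a b` irreducible.  On `Fin (2m)` their number is the one-defect number `b(m)` of law C5-L4
(prim-pcint-2 gen 21). [folklore] -/
noncomputable def defectSet (α : Type*) [LinearOrder α] [Fintype α] : Finset ((α → α) × α × α) :=
  Finset.univ.filter fun t => IsDiag t.1 ∧ IsPair t.1 t.2.1 t.2.2 ∧ IsGood (switchP t.1 t.2.1 t.2.2) ∧ IsGood (switchX t.1 t.2.1 t.2.2)

/-- Membership in `defectSet`. [folklore] -/
theorem mem_defectSet {t : (α → α) × α × α} :
    t ∈ defectSet α ↔ IsDiag t.1 ∧ IsPair t.1 t.2.1 t.2.2 ∧ IsGood (switchP t.1 t.2.1 t.2.2) ∧ IsGood (switchX t.1 t.2.1 t.2.2) := by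
  simp [defectSet]

end Pair

end Summit.CriticalPhenomena.PercolationContinuityZ3.Theorems.Pcint.ChordDiag
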